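import Summits.AtomisticToContinuum.FouriersLaw.Theses.LocalOhmBV
import Summits.AtomisticToContinuum.FouriersLaw.Theses.TransferKernelPositivity
import Summits.AtomisticToContinuum.FouriersLaw.Theorems.LocalOhmBVLocalOhmSymmetryReduction
import Summits.AtomisticToContinuum.FouriersLaw.Theorems.LocalOhmBVLocalOhmStubFiniteResponsePackage
import Summits.AtomisticToContinuum.FouriersLaw.Theorems.LocalOhmBVLocalOhmStubEquilibriumPackageAux1
import Summits.AtomisticToContinuum.FouriersLaw.Theorems.LocalOhmBVLocalOhmStubEquilibriumPackageAux2
import Summits.AtomisticToContinuum.FouriersLaw.Theorems.LocalOhmBVLocalOhmStubEquilibriumPackageAux4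
import Summits.AtomisticToContinuum.FouriersLaw.Theorems.LocalOhmBVLocalOhmStubSoftExtractionWeak
import Summits.AtomisticToContinuum.FouriersLaw.Theorems.LocalOhmBVLocalOhmStubWindowEnergyCovarianceWeak
import Summits.AtomisticToContinuum.FouriersLaw.Theorems.LocalOhmBVLocalOhmStubGibbsTermCovarianceDecay
import Literature.MathematicalPhysics.KineticTheory.InfiniteChainGibbsExistenceShift
import Summits.AtomisticToContinuum.FouriersLaw.Theorems.ParityLiouvilleSeedWindowLimitDefs
import Literature.MathematicalPhysics.KineticTheory.LangevinChainGibbs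

/-!
# `LocalOhm` reduced to two named open statements: the interior LTE estimate and odd-sector rigidity

Crux item stmt-AtomisticToContinuum-12009 (`Summit.AtomisticToContinuum.FouriersLaw.Theses.LocalOhmBV.LocalOhm`,
shared verbatim with `…Theses.TransferKernelPositivity.LocalOhm`), line `registered` (birth; compactness +
linearised odd-sector rigidity). This file is the SORRY-FREE part of the line's skeleton
(`Cruxes/LocalOhm/Lines/birth.lean` after the reshape of lead c4, 2026-08-17): everything except the two stubs of
open-problem strength, which appear here as HYPOTHESES (spelled out, not named):

* (S1) the `N`-uniform interior linearised-LTE estimate (`stub_linearisedLTE` of the skeleton): on bulk windows the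
  first-order NESS response of a window observable is `θ(x) · Cov_{μ_{N,T,T}}(ψ, H_N)/T²` up to
  `A(ℓ) ‖ψ‖_{L²(μ_{N,T,T})} (|d|/(N-1) + WV_x(ℓ))`;
* (S3) linearised odd-sector rigidity in symmetric form (`stub_oddSectorLiouvilleSym` = `OddSectorRigidityLin`): a
  shift-invariant, momentum-reversal-odd, linear, translation-uniformly `L²(μ∞)`-regular, `liouvilleZ`-invariant
  first-order functional on the infinite chain carries no current.

What is PROVED here (no `sorry`, standard axioms):

* `equilibriumPackageWeak` — the equilibrium / thermodynamic-limit package (b1)–(b4) of the extraction with the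
  per-observable window–energy covariance bound (b3'), assembled from the landed clauses
  (`equilibriumPackage_covBondCurrentEnergy`, `…covLiouvilleEnergy`, `…integrableWindow`, `…windowThermodynamicLimit`)
  and the landed stubs T1 `stub_windowEnergyCovarianceWeak_of_termDecay` ∘ T2 `stub_gibbsTermCovarianceDecay`;
* `blowUpLimit` — **the extraction is unconditional**: in the frame of `LocalOhm`, GIVEN (S1), every violating
  sequence yields a shift-invariant Gibbs state `μ∞` and a bad functional `Λ` (linear, translation-uniformly
  `L²(μ∞)`-regular, `liouvilleZ`-invariant, unit current on every bond) — from S2a `stub_finiteResponsePackage`,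
  `equilibriumPackageWeak` and S2c' `stub_softExtractionWeak`, all landed;
* `localOhm_of_linearisedLTE_of_oddSectorLiouvilleSym` — **(S1) → (S3) → `LocalOhmBV.LocalOhm`** (diagonal violating
  sequence, `blowUpLimit`, the landed symmetry reduction `not_unitCurrent_of_symmetricRigidity`);
* `transferKernelPositivity_localOhm_of_linearisedLTE_of_oddSectorLiouvilleSym` — the same for the shared copy.

So the crux is GLUED to exactly two layer-2 statements (S1), (S3); this file is the glue theorem for a planner's
two-layer split (D-0019). Nothing here closes the item: (S1) has no `N`-uniform source (BLR2000 §7) and (S3) is the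
open odd-sector rigidity (false at `lam = β = 0`).
-/

set_option autoImplicit false

noncomputable section

namespace Summit.AtomisticToContinuum.FouriersLaw.Theorems.LocalOhmBirth

open MeasureTheory Filter Topology
open scoped BigOperators
open Literature.MathematicalPhysics.KineticTheory.HeatConduction
open Summit.AtomisticToContinuum.FouriersLaw.Theses.LocalOhmBV (LocalOhm)
open Summit.AtomisticToContinuum.FouriersLaw.Theorems.WindowLimit (embed)

/-- **S2b' `equilibriumPackageWeak`**: for all parameters `> 0` and `T > 0` there is a shift-invariant infinite-volume
Gibbs state `μinf` of `pinnedChain ω₂ lam β γ` with: (b1) integrability of continuous polynomially bounded window /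
finite-`N` observables (also against `H_N`); (b2) the finite-`N` Gibbs identities `Cov(j_i, H_N) = 0`,
`Cov(𝒜F, H_N) = 0` for bulk cylinder `F`; (b3') the PER-OBSERVABLE `N`-uniform window–energy covariance bound
`|Cov_{Gibbs_N}(g ∘ boxRestrictAt a n ∘ embed N c, H_N)| ≤ B(g)`; (b4) the anchor-uniform thermodynamic limit of
deep-window expectations. Assembled from landed results (`equilibriumPackage_*`, T1 ∘ T2). [folklore] -/
theorem equilibriumPackageWeak :
    ∀ ω₂ lam β γ : ℝ, 0 < ω₂ → 0 < lam → 0 < β → 0 < γ → ∀ T : ℝ, 0 < T →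
    ∃ μinf : Measure ChainConfig,
      (pinnedChain ω₂ lam β γ).IsChainGibbsMeasure T μinf ∧ IsShiftInvariant μinf ∧
      (∀ (a : ℤ) (n : ℕ) (g : (Fin (n + 1) → ℝ × ℝ) → ℝ), Continuous g →
        (∃ (C₀ : ℝ) (m : ℕ), ∀ y, |g y| ≤ C₀ * (1 + ‖y‖) ^ m) →
        Integrable (fun σ => g (boxRestrictAt a n σ)) μinf) ∧
      (∀ (N : ℕ) (ψ : PhaseSpace N → ℝ), Continuous ψ →
        (∃ (C₀ : ℝ) (m : ℕ), ∀ z, |ψ z| ≤ C₀ * (1 + ‖z‖) ^ m) →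
        Integrable ψ ((pinnedChain ω₂ lam β γ).gibbsMeasure N T) ∧
          Integrable (fun z => ψ z * (pinnedChain ω₂ lam β γ).hamiltonian N z)
            ((pinnedChain ω₂ lam β γ).gibbsMeasure N T)) ∧
      (∀ (N : ℕ) (i : Fin N),
        (∫ z, (pinnedChain ω₂ lam β γ).bondCurrent N i z * (pinnedChain ω₂ lam β γ).hamiltonian N z
            ∂((pinnedChain ω₂ lam β γ).gibbsMeasure N T)) -
          (∫ z, (pinnedChain ω₂ lam β γ).bondCurrent N i z ∂((pinnedChain ω₂ lam β γ).gibbsMeasure N T)) *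
            (∫ z, (pinnedChain ω₂ lam β γ).hamiltonian N z ∂((pinnedChain ω₂ lam β γ).gibbsMeasure N T)) =
          0) ∧
      (∀ (N : ℕ) (a : ℤ) (n c : ℕ), 1 ≤ a + c → a + c + n + 2 ≤ N →
        ∀ G : (Fin (n + 1) → ℝ × ℝ) → ℝ, ContDiff ℝ 1 G →
        (∃ (C₀ : ℝ) (m : ℕ), ∀ y, |G y| ≤ C₀ * (1 + ‖y‖) ^ m ∧ ‖fderiv ℝ G y‖ ≤ C₀ * (1 + ‖y‖) ^ m) →
        (∫ z, liouvilleZ (pinnedChain ω₂ lam β γ) (G ∘ boxRestrictAt a n) (embed N c z) *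
            (pinnedChain ω₂ lam β γ).hamiltonian N z ∂((pinnedChain ω₂ lam β γ).gibbsMeasure N T)) -
          (∫ z, liouvilleZ (pinnedChain ω₂ lam β γ) (G ∘ boxRestrictAt a n) (embed N c z)
              ∂((pinnedChain ω₂ lam β γ).gibbsMeasure N T)) *
            (∫ z, (pinnedChain ω₂ lam β γ).hamiltonian N z ∂((pinnedChain ω₂ lam β γ).gibbsMeasure N T)) =
          0) ∧
      (∀ (n : ℕ) (g : (Fin (n + 1) → ℝ × ℝ) → ℝ), Continuous g →
        (∃ (C₀ : ℝ) (m : ℕ), ∀ y, |g y| ≤ C₀ * (1 + ‖y‖) ^ m) →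
        ∃ B : ℝ, ∀ (N c : ℕ) (a : ℤ), 0 ≤ a + c → a + c + n < N →
        |(∫ z, g (boxRestrictAt a n (embed N c z)) * (pinnedChain ω₂ lam β γ).hamiltonian N z
              ∂((pinnedChain ω₂ lam β γ).gibbsMeasure N T)) -
            (∫ z, g (boxRestrictAt a n (embed N c z)) ∂((pinnedChain ω₂ lam β γ).gibbsMeasure N T)) *
              (∫ z, (pinnedChain ω₂ lam β γ).hamiltonian N z ∂((pinnedChain ω₂ lam β γ).gibbsMeasure N T))| ≤
          B) ∧
      (∀ (n : ℕ) (g : (Fin (n + 1) → ℝ × ℝ) → ℝ), Continuous g →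
        (∃ (C₀ : ℝ) (m : ℕ), ∀ y, |g y| ≤ C₀ * (1 + ‖y‖) ^ m) →
        ∀ ε : ℝ, 0 < ε → ∃ L N₀ : ℕ, ∀ (N c : ℕ) (a : ℤ), N₀ ≤ N → (L : ℤ) ≤ a + c →
          a + c + n + L < N →
          |(∫ z, g (boxRestrictAt a n (embed N c z)) ∂((pinnedChain ω₂ lam β γ).gibbsMeasure N T)) -
              ∫ σ, g (boxRestrictAt a n σ) ∂μinf| ≤ ε) := by
  intro ω₂ lam β γ hω hl hβ hγ T hT
  obtain ⟨μ, hG, hS, hSS⟩ :=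
    OscillatorChain.exists_isChainGibbsMeasure_shiftInvariant_superstable_pinnedChain γ hω hl.le hβ.le hT
  refine ⟨μ, hG, hS, ?_,
    (Summit.AtomisticToContinuum.FouriersLaw.Theorems.LocalOhmBirth.equilibriumPackage_covLiouvilleEnergy
      ω₂ lam β γ hω hl.le hβ.le T hT).1,
    fun N i => Summit.AtomisticToContinuum.FouriersLaw.Theorems.LocalOhmBirth.equilibriumPackage_covBondCurrentEnergy
      ω₂ lam β γ T N i,
    (Summit.AtomisticToContinuum.FouriersLaw.Theorems.LocalOhmBirth.equilibriumPackage_covLiouvilleEnergy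
      ω₂ lam β γ hω hl.le hβ.le T hT).2,
    stub_windowEnergyCovarianceWeak_of_termDecay stub_gibbsTermCovarianceDecay ω₂ lam β γ hω hl hβ hγ T hT,
    fun n g hg hb ε hε =>
      Summit.AtomisticToContinuum.FouriersLaw.Theorems.LocalOhmBirth.equilibriumPackage_windowThermodynamicLimit
        ω₂ lam β γ hω hl hβ hγ T hT μ hG hS hSS n g hg hb ε hε⟩
  exact fun a n g hg hb =>
    Summit.AtomisticToContinuum.FouriersLaw.Theorems.LocalOhmBirth.equilibriumPackage_integrableWindow
      ω₂ lam β γ hω hl.le hβ.le T hT μ hG hS a n g hg hb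

/-- **`blowUpLimit` — the extraction of the birth line is unconditional.** In the frame of `LocalOhm`
(parameters `> 0`, weak-NESS uniqueness, a steady-state family `μ`, `T > 0`), GIVEN the interior a-priori estimate
(A) (= stub S1, as a hypothesis) and a violating sequence `(N_k, d_k, θ_k, x_k)` (`k ≤ x_k`, `x_k + k + 2 ≤ N_k`,
`k · WV_{x_k}(k) < |d_k|/(N_k - 1)`), there are a shift-invariant Gibbs state `μinf` of the infinite chain and a
functional `Λ` on observables of `ChainConfig` which is (1) linear on continuous polynomially bounded cylinder
observables, (2) translation-uniformly `L²(μinf)`-regular on boxes, (3) annihilates `liouvilleZ` of `C¹` polynomially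
bounded cylinder functions, (4) has unit current on every bond. Composition of the landed S2a
`stub_finiteResponsePackage`, `equilibriumPackageWeak` and S2c' `stub_softExtractionWeak`. [folklore] -/
theorem blowUpLimit :
    ∀ ω₂ lam β γ : ℝ, 0 < ω₂ → 0 < lam → 0 < β → 0 < γ →
    (∀ (N : ℕ) (T_L T_R : ℝ), 0 < T_L → 0 < T_R → ∀ μ ν : Measure (PhaseSpace N),
      (pinnedChain ω₂ lam β γ).IsSteadyState N T_L T_R μ →
      (pinnedChain ω₂ lam β γ).IsSteadyState N T_L T_R ν → μ = ν) →
    ∀ μ : (N : ℕ) → ℝ → ℝ → Measure (PhaseSpace N),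
    (∀ (N : ℕ) (T_L T_R : ℝ), 0 < T_L → 0 < T_R →
      (pinnedChain ω₂ lam β γ).IsSteadyState N T_L T_R (μ N T_L T_R)) →
    ∀ T : ℝ, 0 < T →
    (∀ ℓ : ℕ, ∃ (b : ℕ) (A : ℝ), ∀ (N : ℕ) (d : ℝ) (θ : Fin N → ℝ),
      Tendsto (fun δ : ℝ => (pinnedChain ω₂ lam β γ).totalCurrent (μ N (T + δ / 2) (T - δ / 2)) / δ)
        (𝓝[≠] 0) (𝓝 d) →
      (∀ i : Fin N, Tendsto (fun δ : ℝ => ((∫ x, (x.2 i) ^ 2 ∂(μ N (T + δ / 2) (T - δ / 2))) -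
        ∫ x, (x.2 i) ^ 2 ∂(μ N T T)) / δ) (𝓝[≠] 0) (𝓝 (θ i))) →
      ∀ x : ℕ, b + ℓ ≤ x → x + ℓ + b + 2 ≤ N →
      ∀ ψ : PhaseSpace N → ℝ, Continuous ψ →
        (∀ z z' : PhaseSpace N, (∀ i : Fin N, x ≤ i.val + ℓ → i.val ≤ x + ℓ + 1 →
          z.1 i = z'.1 i ∧ z.2 i = z'.2 i) → ψ z = ψ z') →
        (∃ (C₀ : ℝ) (m : ℕ), ∀ z, |ψ z| ≤ C₀ * (1 + ‖z‖) ^ m) →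
        ∀ ρ : ℝ, Tendsto (fun δ : ℝ => ((∫ z, ψ z ∂(μ N (T + δ / 2) (T - δ / 2))) -
          ∫ z, ψ z ∂(μ N T T)) / δ) (𝓝[≠] 0) (𝓝 ρ) →
        |ρ - (∑ i : Fin N, if i.val = x then θ i else 0) *
            (((∫ z, ψ z * (pinnedChain ω₂ lam β γ).hamiltonian N z ∂(μ N T T)) -
              (∫ z, ψ z ∂(μ N T T)) * (∫ z, (pinnedChain ω₂ lam β γ).hamiltonian N z ∂(μ N T T))) /
              T ^ 2)| ≤
          A * Real.sqrt (∫ z, (ψ z) ^ 2 ∂(μ N T T)) *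
            (|d| / ((N : ℝ) - 1) + ∑ i : Fin N, ∑ j : Fin N,
              (if j.val = i.val + 1 ∧ x ≤ i.val + ℓ ∧ i.val ≤ x + ℓ then |θ j - θ i| else 0))) →
    ∀ (Nk : ℕ → ℕ) (dk : ℕ → ℝ) (θk : (k : ℕ) → Fin (Nk k) → ℝ) (xk : ℕ → ℕ),
    (∀ k : ℕ, Tendsto (fun δ : ℝ =>
        (pinnedChain ω₂ lam β γ).totalCurrent (μ (Nk k) (T + δ / 2) (T - δ / 2)) / δ) (𝓝[≠] 0) (𝓝 (dk k))) →
    (∀ (k : ℕ) (i : Fin (Nk k)), Tendsto (fun δ : ℝ =>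
        ((∫ x, (x.2 i) ^ 2 ∂(μ (Nk k) (T + δ / 2) (T - δ / 2))) - ∫ x, (x.2 i) ^ 2 ∂(μ (Nk k) T T)) / δ)
        (𝓝[≠] 0) (𝓝 (θk k i))) →
    (∀ k : ℕ, k ≤ xk k) → (∀ k : ℕ, xk k + k + 2 ≤ Nk k) →
    (∀ k : ℕ, (k : ℝ) * ∑ i : Fin (Nk k), ∑ j : Fin (Nk k),
        (if j.val = i.val + 1 ∧ xk k ≤ i.val + k ∧ i.val ≤ xk k + k then |θk k j - θk k i| else 0) <
      |dk k| / ((Nk k : ℝ) - 1)) →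
    ∃ (μinf : Measure ChainConfig) (Λ : (ChainConfig → ℝ) → ℝ),
      (pinnedChain ω₂ lam β γ).IsChainGibbsMeasure T μinf ∧ IsShiftInvariant μinf ∧
      (∀ (a : ℤ) (n : ℕ) (c₁ c₂ : ℝ) (g₁ g₂ : (Fin (n + 1) → ℝ × ℝ) → ℝ), Continuous g₁ → Continuous g₂ →
        (∃ (C₀ : ℝ) (m : ℕ), ∀ y, |g₁ y| ≤ C₀ * (1 + ‖y‖) ^ m ∧ |g₂ y| ≤ C₀ * (1 + ‖y‖) ^ m) →
        Λ ((fun y => c₁ * g₁ y + c₂ * g₂ y) ∘ boxRestrictAt a n) =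
          c₁ * Λ (g₁ ∘ boxRestrictAt a n) + c₂ * Λ (g₂ ∘ boxRestrictAt a n)) ∧
      (∀ n : ℕ, ∃ A : ℝ, ∀ (a : ℤ) (g : (Fin (n + 1) → ℝ × ℝ) → ℝ), Continuous g →
        (∃ (C₀ : ℝ) (m : ℕ), ∀ y, |g y| ≤ C₀ * (1 + ‖y‖) ^ m) →
        |Λ (g ∘ boxRestrictAt a n)| ≤ A * Real.sqrt (∫ σ, (g (boxRestrictAt a n σ)) ^ 2 ∂μinf)) ∧
      (∀ (a : ℤ) (n : ℕ) (G : (Fin (n + 1) → ℝ × ℝ) → ℝ), ContDiff ℝ 1 G →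
        (∃ (C₀ : ℝ) (m : ℕ), ∀ y, |G y| ≤ C₀ * (1 + ‖y‖) ^ m ∧ ‖fderiv ℝ G y‖ ≤ C₀ * (1 + ‖y‖) ^ m) →
        Λ (liouvilleZ (pinnedChain ω₂ lam β γ) (G ∘ boxRestrictAt a n)) = 0) ∧
      (∀ i : ℤ, Λ (fun σ => (pinnedChain ω₂ lam β γ).bondCurrentZ σ i) = 1) := by
  intro ω₂ lam β γ hω hl hβ hγ hU μ hμ T hT hA Nk dk θk xk hD hΘ hx₁ hx₂ hlt
  obtain ⟨μinf, hG, hS, hb1, hb1', hb2b, hb2c, hb3, hb4⟩ :=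
    equilibriumPackageWeak ω₂ lam β γ hω hl hβ hγ T hT
  obtain ⟨Λ, h⟩ := stub_softExtractionWeak ω₂ lam β γ hω hl hβ hγ hU μ hμ T hT hA
    (stub_finiteResponsePackage ω₂ lam β γ hω hl hβ hγ hU μ hμ T hT) μinf hG hS hb1 hb1' hb2b hb2c
    hb3 hb4 Nk dk θk xk hD hΘ hx₁ hx₂ hlt
  exact ⟨μinf, Λ, hG, hS, h⟩

/-- **`LocalOhm` from the interior LTE estimate and odd-sector rigidity** (the glue of the birth line): if (S1) the
`N`-uniform interior linearised-LTE estimate holds and (S3) every shift-invariant, odd, linear, translation-uniformly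
`L²(μ∞)`-regular, `liouvilleZ`-invariant first-order functional on the infinite chain has zero current, then
`LocalOhmBV.LocalOhm`. Proof: if no `(C, ℓ, b)` works, the diagonal choice `C = ℓ = b = k` gives a violating
sequence; `blowUpLimit` produces a bad `Λ` with unit current; the landed symmetry reduction
`not_unitCurrent_of_symmetricRigidity` (odd part + shift average) and (S3) contradict it. Both hypotheses are of
open-problem strength (BLR2000 §7; (S3) is false at `lam = β = 0`); this theorem only records that NOTHING ELSE is
needed. [folklore] -/
theorem localOhm_of_linearisedLTE_of_oddSectorLiouvilleSym :
    (∀ ω₂ lam β γ : ℝ, 0 < ω₂ → 0 < lam → 0 < β → 0 < γ →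
      (∀ (N : ℕ) (T_L T_R : ℝ), 0 < T_L → 0 < T_R → ∀ μ ν : Measure (PhaseSpace N),
        (pinnedChain ω₂ lam β γ).IsSteadyState N T_L T_R μ →
        (pinnedChain ω₂ lam β γ).IsSteadyState N T_L T_R ν → μ = ν) →
      ∀ μ : (N : ℕ) → ℝ → ℝ → Measure (PhaseSpace N),
      (∀ (N : ℕ) (T_L T_R : ℝ), 0 < T_L → 0 < T_R →
        (pinnedChain ω₂ lam β γ).IsSteadyState N T_L T_R (μ N T_L T_R)) →
      ∀ T : ℝ, 0 < T →
      ∀ ℓ : ℕ, ∃ (b : ℕ) (A : ℝ), ∀ (N : ℕ) (d : ℝ) (θ : Fin N → ℝ),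
        Tendsto (fun δ : ℝ => (pinnedChain ω₂ lam β γ).totalCurrent (μ N (T + δ / 2) (T - δ / 2)) / δ)
          (𝓝[≠] 0) (𝓝 d) →
        (∀ i : Fin N, Tendsto (fun δ : ℝ => ((∫ x, (x.2 i) ^ 2 ∂(μ N (T + δ / 2) (T - δ / 2))) -
          ∫ x, (x.2 i) ^ 2 ∂(μ N T T)) / δ) (𝓝[≠] 0) (𝓝 (θ i))) →
        ∀ x : ℕ, b + ℓ ≤ x → x + ℓ + b + 2 ≤ N →
        ∀ ψ : PhaseSpace N → ℝ, Continuous ψ →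
          (∀ z z' : PhaseSpace N, (∀ i : Fin N, x ≤ i.val + ℓ → i.val ≤ x + ℓ + 1 →
            z.1 i = z'.1 i ∧ z.2 i = z'.2 i) → ψ z = ψ z') →
          (∃ (C₀ : ℝ) (m : ℕ), ∀ z, |ψ z| ≤ C₀ * (1 + ‖z‖) ^ m) →
          ∀ ρ : ℝ, Tendsto (fun δ : ℝ => ((∫ z, ψ z ∂(μ N (T + δ / 2) (T - δ / 2))) -
            ∫ z, ψ z ∂(μ N T T)) / δ) (𝓝[≠] 0) (𝓝 ρ) →
          |ρ - (∑ i : Fin N, if i.val = x then θ i else 0) *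
              (((∫ z, ψ z * (pinnedChain ω₂ lam β γ).hamiltonian N z ∂(μ N T T)) -
                (∫ z, ψ z ∂(μ N T T)) * (∫ z, (pinnedChain ω₂ lam β γ).hamiltonian N z ∂(μ N T T))) /
                T ^ 2)| ≤
            A * Real.sqrt (∫ z, (ψ z) ^ 2 ∂(μ N T T)) *
              (|d| / ((N : ℝ) - 1) + ∑ i : Fin N, ∑ j : Fin N,
                (if j.val = i.val + 1 ∧ x ≤ i.val + ℓ ∧ i.val ≤ x + ℓ then |θ j - θ i| else 0))) →
    (∀ ω₂ lam β γ : ℝ, 0 < ω₂ → 0 < lam → 0 < β → 0 < γ → ∀ T : ℝ, 0 < T →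
      ∀ μinf : Measure ChainConfig, (pinnedChain ω₂ lam β γ).IsChainGibbsMeasure T μinf →
      IsShiftInvariant μinf →
      ∀ Λ : (ChainConfig → ℝ) → ℝ,
      (∀ (a : ℤ) (n : ℕ) (g : (Fin (n + 1) → ℝ × ℝ) → ℝ), Continuous g →
        (∃ (C₀ : ℝ) (m : ℕ), ∀ y, |g y| ≤ C₀ * (1 + ‖y‖) ^ m) →
        Λ ((g ∘ boxRestrictAt a n) ∘ shift) = Λ (g ∘ boxRestrictAt a n)) →
      (∀ (a : ℤ) (n : ℕ) (g : (Fin (n + 1) → ℝ × ℝ) → ℝ), Continuous g →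
        (∃ (C₀ : ℝ) (m : ℕ), ∀ y, |g y| ≤ C₀ * (1 + ‖y‖) ^ m) →
        Λ ((g ∘ boxRestrictAt a n) ∘ momentumReversalZ) = -Λ (g ∘ boxRestrictAt a n)) →
      (∀ (a : ℤ) (n : ℕ) (c₁ c₂ : ℝ) (g₁ g₂ : (Fin (n + 1) → ℝ × ℝ) → ℝ), Continuous g₁ → Continuous g₂ →
        (∃ (C₀ : ℝ) (m : ℕ), ∀ y, |g₁ y| ≤ C₀ * (1 + ‖y‖) ^ m ∧ |g₂ y| ≤ C₀ * (1 + ‖y‖) ^ m) →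
        Λ ((fun y => c₁ * g₁ y + c₂ * g₂ y) ∘ boxRestrictAt a n) =
          c₁ * Λ (g₁ ∘ boxRestrictAt a n) + c₂ * Λ (g₂ ∘ boxRestrictAt a n)) →
      (∀ n : ℕ, ∃ A : ℝ, ∀ (a : ℤ) (g : (Fin (n + 1) → ℝ × ℝ) → ℝ), Continuous g →
        (∃ (C₀ : ℝ) (m : ℕ), ∀ y, |g y| ≤ C₀ * (1 + ‖y‖) ^ m) →
        |Λ (g ∘ boxRestrictAt a n)| ≤ A * Real.sqrt (∫ σ, (g (boxRestrictAt a n σ)) ^ 2 ∂μinf)) →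
      (∀ (a : ℤ) (n : ℕ) (G : (Fin (n + 1) → ℝ × ℝ) → ℝ), ContDiff ℝ 1 G →
        (∃ (C₀ : ℝ) (m : ℕ), ∀ y, |G y| ≤ C₀ * (1 + ‖y‖) ^ m ∧ ‖fderiv ℝ G y‖ ≤ C₀ * (1 + ‖y‖) ^ m) →
        Λ (liouvilleZ (pinnedChain ω₂ lam β γ) (G ∘ boxRestrictAt a n)) = 0) →
      Λ (fun σ => (pinnedChain ω₂ lam β γ).bondCurrentZ σ 0) = 0) →
    Summit.AtomisticToContinuum.FouriersLaw.Theses.LocalOhmBV.LocalOhm := by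
  intro hS1 hS3 ω₂ lam β γ hω hl hβ hγ hU μ hμ T hT
  by_contra hneg
  -- with `C = ℓ = b = k` the local Ohm inequality fails at some bulk bond, for every `k`
  have hk : ∀ k : ℕ, ∃ (N : ℕ) (d : ℝ) (θ : Fin N → ℝ),
      Tendsto (fun δ : ℝ => (pinnedChain ω₂ lam β γ).totalCurrent (μ N (T + δ / 2) (T - δ / 2)) / δ)
        (𝓝[≠] 0) (𝓝 d) ∧
      (∀ i : Fin N, Tendsto (fun δ : ℝ => ((∫ x, (x.2 i) ^ 2 ∂(μ N (T + δ / 2) (T - δ / 2))) -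
        ∫ x, (x.2 i) ^ 2 ∂(μ N T T)) / δ) (𝓝[≠] 0) (𝓝 (θ i))) ∧
      ∃ x : ℕ, k ≤ x ∧ x + k + 2 ≤ N ∧
        (k : ℝ) * ∑ i : Fin N, ∑ j : Fin N,
            (if j.val = i.val + 1 ∧ x ≤ i.val + k ∧ i.val ≤ x + k then |θ j - θ i| else 0) <
          |d| / ((N : ℝ) - 1) := by
    intro k
    by_contra hk'
    push Not at hk'
    exact hneg ⟨(k : ℝ), k, k, fun N d θ hd hθ x hx₁ hx₂ => hk' N d θ hd hθ x hx₁ hx₂⟩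
  choose Nk dk θk hD hΘ xk hx₁ hx₂ hlt using hk
  -- blow-up: a bad first-order functional on the infinite chain (S2 fed with the a-priori estimate S1)
  obtain ⟨μinf, Λ, hGibbs, hshift, hlin, hbd, hinv, hcur⟩ :=
    blowUpLimit ω₂ lam β γ hω hl hβ hγ hU μ hμ T hT
      (hS1 ω₂ lam β γ hω hl hβ hγ hU μ hμ T hT) Nk dk θk xk hD hΘ hx₁ hx₂ hlt
  -- rigidity: symmetrise (odd part, shift average — landed glue) and apply S3 in its symmetric form
  exact not_unitCurrent_of_symmetricRigidity
    hS3 hω hl hβ hγ hT hGibbs hshift Λ hlin hbd hinv hcur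

/-- The shared copy: (S1) → (S3) → `TransferKernelPositivity.LocalOhm` (the two route decls are definitionally equal).
[folklore] -/
theorem transferKernelPositivity_localOhm_of_linearisedLTE_of_oddSectorLiouvilleSym
    (hS1 :
      ∀ ω₂ lam β γ : ℝ, 0 < ω₂ → 0 < lam → 0 < β → 0 < γ →
      (∀ (N : ℕ) (T_L T_R : ℝ), 0 < T_L → 0 < T_R → ∀ μ ν : Measure (PhaseSpace N),
        (pinnedChain ω₂ lam β γ).IsSteadyState N T_L T_R μ →
        (pinnedChain ω₂ lam β γ).IsSteadyState N T_L T_R ν → μ = ν) →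
      ∀ μ : (N : ℕ) → ℝ → ℝ → Measure (PhaseSpace N),
      (∀ (N : ℕ) (T_L T_R : ℝ), 0 < T_L → 0 < T_R →
        (pinnedChain ω₂ lam β γ).IsSteadyState N T_L T_R (μ N T_L T_R)) →
      ∀ T : ℝ, 0 < T →
      ∀ ℓ : ℕ, ∃ (b : ℕ) (A : ℝ), ∀ (N : ℕ) (d : ℝ) (θ : Fin N → ℝ),
        Tendsto (fun δ : ℝ => (pinnedChain ω₂ lam β γ).totalCurrent (μ N (T + δ / 2) (T - δ / 2)) / δ)
          (𝓝[≠] 0) (𝓝 d) →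
        (∀ i : Fin N, Tendsto (fun δ : ℝ => ((∫ x, (x.2 i) ^ 2 ∂(μ N (T + δ / 2) (T - δ / 2))) -
          ∫ x, (x.2 i) ^ 2 ∂(μ N T T)) / δ) (𝓝[≠] 0) (𝓝 (θ i))) →
        ∀ x : ℕ, b + ℓ ≤ x → x + ℓ + b + 2 ≤ N →
        ∀ ψ : PhaseSpace N → ℝ, Continuous ψ →
          (∀ z z' : PhaseSpace N, (∀ i : Fin N, x ≤ i.val + ℓ → i.val ≤ x + ℓ + 1 →
            z.1 i = z'.1 i ∧ z.2 i = z'.2 i) → ψ z = ψ z') →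
          (∃ (C₀ : ℝ) (m : ℕ), ∀ z, |ψ z| ≤ C₀ * (1 + ‖z‖) ^ m) →
          ∀ ρ : ℝ, Tendsto (fun δ : ℝ => ((∫ z, ψ z ∂(μ N (T + δ / 2) (T - δ / 2))) -
            ∫ z, ψ z ∂(μ N T T)) / δ) (𝓝[≠] 0) (𝓝 ρ) →
          |ρ - (∑ i : Fin N, if i.val = x then θ i else 0) *
              (((∫ z, ψ z * (pinnedChain ω₂ lam β γ).hamiltonian N z ∂(μ N T T)) -
                (∫ z, ψ z ∂(μ N T T)) * (∫ z, (pinnedChain ω₂ lam β γ).hamiltonian N z ∂(μ N T T))) /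
                T ^ 2)| ≤
            A * Real.sqrt (∫ z, (ψ z) ^ 2 ∂(μ N T T)) *
              (|d| / ((N : ℝ) - 1) + ∑ i : Fin N, ∑ j : Fin N,
                (if j.val = i.val + 1 ∧ x ≤ i.val + ℓ ∧ i.val ≤ x + ℓ then |θ j - θ i| else 0)))
    (hS3 :
      ∀ ω₂ lam β γ : ℝ, 0 < ω₂ → 0 < lam → 0 < β → 0 < γ → ∀ T : ℝ, 0 < T →
      ∀ μinf : Measure ChainConfig, (pinnedChain ω₂ lam β γ).IsChainGibbsMeasure T μinf →
      IsShiftInvariant μinf →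
      ∀ Λ : (ChainConfig → ℝ) → ℝ,
      (∀ (a : ℤ) (n : ℕ) (g : (Fin (n + 1) → ℝ × ℝ) → ℝ), Continuous g →
        (∃ (C₀ : ℝ) (m : ℕ), ∀ y, |g y| ≤ C₀ * (1 + ‖y‖) ^ m) →
        Λ ((g ∘ boxRestrictAt a n) ∘ shift) = Λ (g ∘ boxRestrictAt a n)) →
      (∀ (a : ℤ) (n : ℕ) (g : (Fin (n + 1) → ℝ × ℝ) → ℝ), Continuous g →
        (∃ (C₀ : ℝ) (m : ℕ), ∀ y, |g y| ≤ C₀ * (1 + ‖y‖) ^ m) →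
        Λ ((g ∘ boxRestrictAt a n) ∘ momentumReversalZ) = -Λ (g ∘ boxRestrictAt a n)) →
      (∀ (a : ℤ) (n : ℕ) (c₁ c₂ : ℝ) (g₁ g₂ : (Fin (n + 1) → ℝ × ℝ) → ℝ), Continuous g₁ → Continuous g₂ →
        (∃ (C₀ : ℝ) (m : ℕ), ∀ y, |g₁ y| ≤ C₀ * (1 + ‖y‖) ^ m ∧ |g₂ y| ≤ C₀ * (1 + ‖y‖) ^ m) →
        Λ ((fun y => c₁ * g₁ y + c₂ * g₂ y) ∘ boxRestrictAt a n) =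
          c₁ * Λ (g₁ ∘ boxRestrictAt a n) + c₂ * Λ (g₂ ∘ boxRestrictAt a n)) →
      (∀ n : ℕ, ∃ A : ℝ, ∀ (a : ℤ) (g : (Fin (n + 1) → ℝ × ℝ) → ℝ), Continuous g →
        (∃ (C₀ : ℝ) (m : ℕ), ∀ y, |g y| ≤ C₀ * (1 + ‖y‖) ^ m) →
        |Λ (g ∘ boxRestrictAt a n)| ≤ A * Real.sqrt (∫ σ, (g (boxRestrictAt a n σ)) ^ 2 ∂μinf)) →
      (∀ (a : ℤ) (n : ℕ) (G : (Fin (n + 1) → ℝ × ℝ) → ℝ), ContDiff ℝ 1 G →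
        (∃ (C₀ : ℝ) (m : ℕ), ∀ y, |G y| ≤ C₀ * (1 + ‖y‖) ^ m ∧ ‖fderiv ℝ G y‖ ≤ C₀ * (1 + ‖y‖) ^ m) →
        Λ (liouvilleZ (pinnedChain ω₂ lam β γ) (G ∘ boxRestrictAt a n)) = 0) →
      Λ (fun σ => (pinnedChain ω₂ lam β γ).bondCurrentZ σ 0) = 0) :
    Summit.AtomisticToContinuum.FouriersLaw.Theses.TransferKernelPositivity.LocalOhm :=
  localOhm_of_linearisedLTE_of_oddSectorLiouvilleSym hS1 hS3

end Summit.AtomisticToContinuum.FouriersLaw.Theorems.LocalOhmBirth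

end
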